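import Mathlib
import Literature.Barriers.PneNP.TSPExtensionComplexityMatchingFace
import HarnessLib

/-!
# Cell pnp-psdrank, route `ChebyshevTracialDesign`: the explicit TWO-ROW SPHERICAL VECTOR of the matching
# Gelfand pair — the down-kernel identity (crux `TracialDecayExp20`, stmt-PneNP-19878; eng MEMO-16 (eng g16) Lemma A)

Engine brick (eng g16, MEMO-16 (eng) §1.2), theorems only (no definitions). For the Gelfand pair `(S_{2m}, B_m)`
(perfect matchings of `K_{2m}`) the `B_M`-spherical vector of the two-row constituent `S^{(n−2ℓ, 2ℓ)} ⊂ ℝ^{C([n],2ℓ)}`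
— realised as the kernel of the down map `(d v)(S) = Σ_{x ∉ S} v(S ∪ {x})` on `2ℓ`-subsets — is `v_M(T) = f_ℓ(j_M(T))`,
`j_M(T)` = number of edges of `M` inside `T`, where `(2ℓ−1−2i)·f_ℓ(i+1) = −(n−4ℓ+2+2i)·f_ℓ(i)`. This file proves the
combinatorial heart of that statement for a perfect matching `M` of an arbitrary finite vertex type (the tree's
`IsPMOn univ M` and its `partner` map, `TSPExtensionComplexityMatchingFace`). Throughout, the INNER COUNT of a vertex
set `T` is `#{v ∈ T : partner v ∈ T}` (twice the number of edges of `M` inside `T`) and the EXPOSED COUNT is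
`#{v ∈ T : partner v ∉ T}`; both are written out in full in every statement.
* §1 `inner(insert x S) = inner(S) + 2·[partner x ∈ S]` for `x ∉ S`; the points outside `S` whose partner lies in `S`
  are equinumerous with the exposed points of `S` (partner involution), the other outside points number `|Sᶜ| − exposed`;
  the inner count is even.
* §2 THE DOWN-KERNEL IDENTITY: for any profile `g` of the inner count satisfying the single linear relation
  `e·g(c+2) + (|Sᶜ| − e)·g(c) = 0` at `c = inner(S)`, `e = exposed(S)`: `Σ_{x ∉ S} g(inner(S ∪ {x})) = 0`.
* §3 For `|S| = 2ℓ − 1` in a vertex type of size `n` this relation is the two-row recursion: every `F : ℕ → ℤ` with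
  `(2ℓ−1−2i)·F(i+1) = −(n−4ℓ+2+2i)·F(i)` (`i < ℓ`) gives `Σ_{x ∉ S} F(inner(S ∪ {x})/2) = 0`, i.e. `T ↦ F(j_M(T))` is
  killed by `d`, hence lies in `S^{(n−2ℓ,2ℓ)}` (the identification `ker d = S^{(n−k,k)}` for `2k ≤ n` is standard
  representation theory, NOT formalised here); and the explicit solution
  `F(i) = (−1)^i·Π_{i'<i}(n−4ℓ+2+2i')·Π_{i≤i'<ℓ}(2ℓ−1−2i')` satisfies the recursion.
With lit g24's identity (R) this makes the two-row isotypic weights `q̂_s((m−ℓ,ℓ)) = ‖E_F v_M‖²/‖v_M‖²` of the cut-pair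
kernel exactly computable at every `n` (MEMO-16 (eng) §1–§2: validated on all 722 certified values of MEMO-15; zonal
limit law `n^ℓ q̂ → Z_λ̄(1_{K−1})`).
[cite: Rothvoss2017, §1 (PDF p. 4: perfect matchings of `K_n`, "for parity reasons")] — the matching vocabulary; the
spherical-function background is Macdonald, *Symmetric Functions and Hall Polynomials*, VII.2 (not used formally).
Stature: support/instrument (elementary double counting about one perfect matching). WHAT THIS IS NOT: no statement
about designs, psd strategies, the dense cell or psd rank; no P-vs-NP content.
-/

set_option linter.dupNamespace false -- `Summit.PneNP.PneNP.…`: summit = sub-problem (D-0017)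

namespace Summit.PneNP.PneNP.Theorems.ChebyshevTracialDesignTwoRowSpherical

open Finset Literature.Barriers.PneNP

/-! ### §1 Inner and exposed points of a vertex set under a perfect matching -/

section Counting

variable {α : Type*} [Fintype α] [DecidableEq α] {M : Finset (Sym2 α)} (hM : IsPMOn (univ : Finset α) M)
include hM

/-- Inner and exposed points partition `T`. [folklore] -/
theorem inner_add_exposed (T : Finset α) :
    (T.filter fun v => hM.partner v ∈ T).card + (T.filter fun v => hM.partner v ∉ T).card = T.card :=
  card_filter_add_card_filter_not _

/-- The partner map is injective (it is an involution). [folklore] -/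
theorem partner_injective : Function.Injective hM.partner := by
  intro v w h
  have := congrArg hM.partner h
  rwa [hM.partner_partner, hM.partner_partner] at this

/-- Adding a point `x ∉ S`: the inner count grows by `2` if the partner of `x` lies in `S` (the new inner edge
`{x, partner x}` has two endpoints) and is unchanged otherwise. [folklore] -/
theorem inner_insert {S : Finset α} {x : α} (hx : x ∉ S) :
    ((insert x S).filter fun v => hM.partner v ∈ insert x S).card =
      (S.filter fun v => hM.partner v ∈ S).card + if hM.partner x ∈ S then 2 else 0 := by
  by_cases h : hM.partner x ∈ S
  · rw [if_pos h]
    have hq : hM.partner x ∈ insert x S := mem_insert_of_mem h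
    rw [filter_insert, if_pos hq]
    have hxnot : x ∉ S.filter fun v => hM.partner v ∈ insert x S := fun hmem => hx (mem_filter.1 hmem).1
    rw [card_insert_of_notMem hxnot]
    -- the filter over `S`: old inner points plus the single point `partner x`
    have hset : (S.filter fun v => hM.partner v ∈ insert x S) =
        insert (hM.partner x) (S.filter fun v => hM.partner v ∈ S) := by
      ext v
      simp only [mem_filter, mem_insert]
      constructor
      · rintro ⟨hv, hpx | hpS⟩
        · left
          have := congrArg hM.partner hpx
          rw [hM.partner_partner] at this
          exact this
        · exact Or.inr ⟨hv, hpS⟩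
      · rintro (rfl | ⟨hv, hpS⟩)
        · exact ⟨h, Or.inl (hM.partner_partner x)⟩
        · exact ⟨hv, Or.inr hpS⟩
    have hnot : hM.partner x ∉ S.filter fun v => hM.partner v ∈ S := by
      intro hmem
      have := (mem_filter.1 hmem).2
      rw [hM.partner_partner] at this
      exact hx this
    rw [hset, card_insert_of_notMem hnot]
  · rw [if_neg h, add_zero]
    have hq : hM.partner x ∉ insert x S := by
      rw [mem_insert, not_or]
      exact ⟨hM.partner_ne x, h⟩
    rw [filter_insert, if_neg hq]
    congr 1
    apply filter_congr
    intro v hv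
    rw [mem_insert]
    constructor
    · rintro (hpx | hpS)
      · exfalso
        have := congrArg hM.partner hpx
        rw [hM.partner_partner] at this
        rw [this] at hv
        exact h hv
      · exact hpS
    · exact fun hpS => Or.inr hpS

/-- The points outside `S` whose partner lies in `S` are the partners of the exposed points of `S`; in particular
there are `exposed(S)` of them. [folklore] -/
theorem card_compl_filter_partner_mem (S : Finset α) :
    (Sᶜ.filter fun x => hM.partner x ∈ S).card = (S.filter fun v => hM.partner v ∉ S).card := by
  have himg : (S.filter fun v => hM.partner v ∉ S).image hM.partner = Sᶜ.filter fun x => hM.partner x ∈ S := by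
    ext x
    simp only [mem_image, mem_filter, mem_compl]
    constructor
    · rintro ⟨v, ⟨hv, hout⟩, rfl⟩
      exact ⟨hout, by rw [hM.partner_partner]; exact hv⟩
    · rintro ⟨hxS, hpx⟩
      exact ⟨hM.partner x, ⟨hpx, by rw [hM.partner_partner]; exact hxS⟩, hM.partner_partner x⟩
  rw [← himg, card_image_of_injective _ (partner_injective hM)]

/-- The remaining points outside `S` (partner also outside `S`) number `|Sᶜ| − exposed(S)`. [folklore] -/
theorem card_compl_filter_partner_not_mem (S : Finset α) :
    (Sᶜ.filter fun x => hM.partner x ∉ S).card = Sᶜ.card - (S.filter fun v => hM.partner v ∉ S).card := by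
  have h := card_filter_add_card_filter_not (s := Sᶜ) (fun x => hM.partner x ∈ S)
  rw [card_compl_filter_partner_mem hM S] at h
  omega

/-- The exposed points are at most `|Sᶜ|` in number (their partners are distinct points of `Sᶜ`). [folklore] -/
theorem exposed_le_card_compl (S : Finset α) : (S.filter fun v => hM.partner v ∉ S).card ≤ Sᶜ.card := by
  rw [← card_compl_filter_partner_mem hM S]
  exact card_filter_le _ _

/-- The inner points come in partner pairs: the inner count is even. [folklore] -/
theorem even_inner (T : Finset α) : Even (T.filter fun v => hM.partner v ∈ T).card := by
  set U := T.filter fun v => hM.partner v ∈ T with hU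
  have hin : ∀ v ∈ U, hM.partner v ∈ U := by
    intro v hv
    rw [hU, mem_filter] at hv ⊢
    exact ⟨hv.2, by rw [hM.partner_partner]; exact hv.1⟩
  let f : α → Sym2 α := fun v => s(v, hM.partner v)
  have hcard := Finset.card_eq_sum_card_fiberwise (f := f) (s := U) (t := U.image f)
    (fun v hv => mem_image_of_mem f hv)
  have htwo : ∀ e ∈ U.image f, (U.filter fun v => f v = e).card = 2 := by
    intro e he
    obtain ⟨v, hv, rfl⟩ := mem_image.1 he
    have hset : (U.filter fun w => f w = f v) = {v, hM.partner v} := by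
      ext w
      simp only [mem_filter, mem_insert, mem_singleton, f]
      constructor
      · rintro ⟨-, h⟩
        have hw : w ∈ s(v, hM.partner v) := by rw [← h]; exact Sym2.mem_mk_left _ _
        exact Sym2.mem_iff.1 hw
      · rintro (rfl | rfl)
        · exact ⟨hv, rfl⟩
        · refine ⟨hin v hv, ?_⟩
          rw [hM.partner_partner, Sym2.eq_swap]
    rw [hset, card_pair (hM.partner_ne v).symm]
  rw [sum_congr rfl htwo, sum_const, smul_eq_mul] at hcard
  exact ⟨(U.image f).card, by omega⟩

/-! ### §2 The down-kernel identity -/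

/-- **Down-kernel identity.** If a profile `g` of the inner count satisfies the single linear relation
`e·g(c+2) + (|Sᶜ|−e)·g(c) = 0` at `c = inner(S)`, `e = exposed(S)`, then the down map kills `T ↦ g(inner(T))` at `S`:
`Σ_{x ∉ S} g(inner(S ∪ {x})) = 0` (the `|Sᶜ| − e` non-exposed outside points leave the count unchanged, the `e` partners
of exposed points raise it by `2`). [folklore] -/
theorem down_sum_eq_zero {R : Type*} [CommRing R] (S : Finset α) (g : ℕ → R)
    (hrel : ((S.filter fun v => hM.partner v ∉ S).card : R) * g ((S.filter fun v => hM.partner v ∈ S).card + 2) +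
      ((Sᶜ.card - (S.filter fun v => hM.partner v ∉ S).card : ℕ) : R) *
        g (S.filter fun v => hM.partner v ∈ S).card = 0) :
    ∑ x ∈ Sᶜ, g ((insert x S).filter fun v => hM.partner v ∈ insert x S).card = 0 := by
  have hstep : ∀ x ∈ Sᶜ, g ((insert x S).filter fun v => hM.partner v ∈ insert x S).card =
      if hM.partner x ∈ S then g ((S.filter fun v => hM.partner v ∈ S).card + 2)
      else g (S.filter fun v => hM.partner v ∈ S).card := by
    intro x hx
    rw [inner_insert hM (mem_compl.1 hx)]
    split_ifs <;> simp
  rw [sum_congr rfl hstep, sum_ite, sum_const, sum_const, card_compl_filter_partner_mem hM S,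
    card_compl_filter_partner_not_mem hM S, nsmul_eq_mul, nsmul_eq_mul]
  exact hrel

/-! ### §3 The two-row recursion -/

/-- **Two-row profiles lie in the kernel of the down map.** In a vertex type of size `n`, for every `F : ℕ → ℤ` obeying
the two-row recursion `(2ℓ−1−2i)·F(i+1) = −(n−4ℓ+2+2i)·F(i)` (`i < ℓ`) and every `(2ℓ−1)`-subset `S`:
`Σ_{x ∉ S} F(inner(S ∪ {x})/2) = 0`. (With `j_M(T) = inner(T)/2` = number of inner edges: `T ↦ F(j_M(T))` is killed by
`d`; the reading `ker d = S^{(n−2ℓ,2ℓ)}` for `2·2ℓ ≤ n` is not formalised here.) [folklore] -/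
theorem twoRow_down_sum_eq_zero (n ℓ : ℕ) (hn : Fintype.card α = n) (F : ℕ → ℤ)
    (hF : ∀ i, i < ℓ → (2 * (ℓ : ℤ) - 1 - 2 * i) * F (i + 1) = -(((n : ℤ) - 4 * ℓ + 2 + 2 * i) * F i))
    (S : Finset α) (hS : S.card = 2 * ℓ - 1) (hℓ : 1 ≤ ℓ) :
    ∑ x ∈ Sᶜ, F (((insert x S).filter fun v => hM.partner v ∈ insert x S).card / 2) = 0 := by
  -- write `inner(S) = 2 i` and `exposed(S) = 2ℓ − 1 − 2 i`
  obtain ⟨i, hi⟩ := even_inner hM S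
  have hsum := inner_add_exposed hM S
  have hle := exposed_le_card_compl hM S
  have hcompl : Sᶜ.card = n - (2 * ℓ - 1) := by rw [card_compl, hn, hS]
  have hil : i < ℓ := by omega
  have hexp : (S.filter fun v => hM.partner v ∉ S).card = 2 * ℓ - 1 - 2 * i := by omega
  -- apply the abstract identity to `g c := F(c/2)`
  have key := down_sum_eq_zero hM S (fun c => F (c / 2)) ?_
  · simpa using key
  · have h1 : ((S.filter fun v => hM.partner v ∈ S).card + 2) / 2 = i + 1 := by omega
    have h2 : (S.filter fun v => hM.partner v ∈ S).card / 2 = i := by omega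
    simp only [h1, h2]
    have hrec := hF i hil
    have hcast1 : (((S.filter fun v => hM.partner v ∉ S).card : ℕ) : ℤ) = 2 * (ℓ : ℤ) - 1 - 2 * i := by
      rw [hexp]; push_cast [show 2 * i ≤ 2 * ℓ - 1 by omega, show 1 ≤ 2 * ℓ by omega]; ring
    have hcast2 : ((Sᶜ.card - (S.filter fun v => hM.partner v ∉ S).card : ℕ) : ℤ) =
        (n : ℤ) - 4 * ℓ + 2 + 2 * i := by
      rw [Nat.cast_sub hle, hcompl, hexp]
      push_cast [show 2 * ℓ - 1 ≤ n by omega, show 2 * i ≤ 2 * ℓ - 1 by omega, show 1 ≤ 2 * ℓ by omega]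
      ring
    rw [hcast1, hcast2]
    linear_combination hrec

end Counting

/-- The explicit integer-valued solution of the two-row recursion,
`F(i) = (−1)^i · Π_{i'<i} (n−4ℓ+2+2i') · Π_{i≤i'<ℓ} (2ℓ−1−2i')` (a denominator-free multiple of `f_ℓ`, MEMO-16 (eng)
§1.2): `(2ℓ−1−2i)·F(i+1) = −(n−4ℓ+2+2i)·F(i)` for `i < ℓ`. [folklore] -/
theorem twoRow_explicit_recursion (n ℓ i : ℕ) (hi : i < ℓ) :
    (2 * (ℓ : ℤ) - 1 - 2 * i) *
        ((-1) ^ (i + 1) * (∏ i' ∈ range (i + 1), ((n : ℤ) - 4 * ℓ + 2 + 2 * i')) *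
          ∏ i' ∈ Ico (i + 1) ℓ, (2 * (ℓ : ℤ) - 1 - 2 * i')) =
      -(((n : ℤ) - 4 * ℓ + 2 + 2 * i) *
        ((-1) ^ i * (∏ i' ∈ range i, ((n : ℤ) - 4 * ℓ + 2 + 2 * i')) *
          ∏ i' ∈ Ico i ℓ, (2 * (ℓ : ℤ) - 1 - 2 * i'))) := by
  rw [prod_range_succ, Finset.prod_eq_prod_Ico_succ_bot hi, pow_succ]
  ring

/-- Packaging §3: the explicit profile is killed by the down map on `(2ℓ−1)`-subsets (combine
`twoRow_explicit_recursion` with `twoRow_down_sum_eq_zero`). [folklore] -/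
theorem twoRow_explicit_down_sum_eq_zero {α : Type*} [Fintype α] [DecidableEq α] {M : Finset (Sym2 α)}
    (hM : IsPMOn (univ : Finset α) M) (n ℓ : ℕ) (hn : Fintype.card α = n) (S : Finset α)
    (hS : S.card = 2 * ℓ - 1) (hℓ : 1 ≤ ℓ) :
    ∑ x ∈ Sᶜ, (fun i : ℕ => (-1 : ℤ) ^ i * (∏ i' ∈ range i, ((n : ℤ) - 4 * ℓ + 2 + 2 * i')) *
        ∏ i' ∈ Ico i ℓ, (2 * (ℓ : ℤ) - 1 - 2 * i'))
      (((insert x S).filter fun v => hM.partner v ∈ insert x S).card / 2) = 0 :=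
  twoRow_down_sum_eq_zero hM n ℓ hn
    (fun i : ℕ => (-1 : ℤ) ^ i * (∏ i' ∈ range i, ((n : ℤ) - 4 * ℓ + 2 + 2 * i')) *
      ∏ i' ∈ Ico i ℓ, (2 * (ℓ : ℤ) - 1 - 2 * i'))
    (fun i hi => twoRow_explicit_recursion n ℓ i hi) S hS hℓ

end Summit.PneNP.PneNP.Theorems.ChebyshevTracialDesignTwoRowSpherical
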